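import Mathlib
import Summits.MatrixMultiplication.MatrixMultiplication.Theorems.SnSubsetDichotomyHyperoctahedralThresholdSupplyAvoiding
import Summits.MatrixMultiplication.MatrixMultiplication.Theorems.SnSubsetDichotomyHyperoctahedralThresholdSelfCleanDarts

/-!
# Counted supply of GOOD same-colour structures (crux `HyperoctahedralThreshold`, open core `stub_poorRigidCore`; siege k9)

Third brick of the dart-level bookkeeping (memo `memo-k9-dart-bookkeeping.md`, evidence on stmt-MatrixMultiplication-10883):
the restricted supply `sameColourSupply_restricted` (p116043) run on the darts that avoid a forbidden set `S` AND are self-clean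
(both restrictions are cheap: `card_darts_avoiding_ge`, p116043, and `card_selfUnclean_le`, `…SelfCleanDarts`), with both
properties inherited by the structures position by position (`structure_avoids_of_darts_avoid`, p116043;
`structure_halfClean_of_darts_clean` here).  Output: `goodStructureSupply` / `stub_goodStructureSupply` —
`(n·2^k - 2(k+1)|S|·2^k - 3(k+1)²·2^k·Φ)² ≤ (n² - n)·(n·2^k + Σ_{i<k} 3^i · #{good structures of length 2k-2i})` for any predicate
`good` implied by (structure ∧ `S`-free ∧ half-clean).  The structures so counted can fail to be clean only through MUTUAL defects
between a rung of the first half and a rung of the second half — the residual of the reflection route at dart level.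

Conventions as in the sibling files (`x · g := g.foldl (fun v b => μ b v) x`; darts `(a, g)`, `|g| = k`, `first(g) ≠ c`; structures
`(a, g')`, `|g'| = 2k - 2i`, `μ c (a·g') = (μ c a)·g'`).  Pure finite combinatorics; no definitions.
-/

set_option linter.dupNamespace false

namespace Summit.MatrixMultiplication.MatrixMultiplication.Theorems.HyperoctahedralThreshold.GoodStructureSupply

open Finset
open Summit.MatrixMultiplication.MatrixMultiplication.Theorems.HyperoctahedralThreshold.Supply
open Summit.MatrixMultiplication.MatrixMultiplication.Theorems.HyperoctahedralThreshold.SupplyAvoiding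
open Summit.MatrixMultiplication.MatrixMultiplication.Theorems.HyperoctahedralThreshold.SelfCleanDarts

variable {n : ℕ}

/-- **Half-cleanness is inherited.**  If both darts reconstructed from `(sfx, (a, g'))` are self-clean (any two of their rungs at
times `≤ k` are equal, swapped or disjoint) and `(a, g')` is a structure, then the structure is HALF-CLEAN: any two of its rungs at
positions both `≤ k - i`, or both `≥ k - i`, are equal, swapped or disjoint (`traj_first_half`, `traj_second_half`). -/
theorem structure_halfClean_of_darts_clean (μ : Fin 3 → Equiv.Perm (Fin n)) (hμ : ∀ b, μ b * μ b = 1) (c : Fin 3)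
    {k i : ℕ} (hi : i < k) {a : Fin n} {g' sfx : List (Fin 3)} (hl : g'.length = 2 * k - 2 * i)
    (hstr : μ c (g'.foldl (fun v b => μ b v) a) = g'.foldl (fun v b => μ b v) (μ c a))
    (h₁ : ∀ s ∈ Finset.range (k + 1), ∀ t ∈ Finset.range (k + 1),
      ((((g'.take (k - i) ++ sfx).take s).foldl (fun v b => μ b v) a = ((g'.take (k - i) ++ sfx).take t).foldl (fun v b => μ b v) a ∧ ((g'.take (k - i) ++ sfx).take s).foldl (fun v b => μ b v) (μ c a) = ((g'.take (k - i) ++ sfx).take t).foldl (fun v b => μ b v) (μ c a)) ∨ (((g'.take (k - i) ++ sfx).take s).foldl (fun v b => μ b v) a = ((g'.take (k - i) ++ sfx).take t).foldl (fun v b => μ b v) (μ c a) ∧ ((g'.take (k - i) ++ sfx).take s).foldl (fun v b => μ b v) (μ c a) = ((g'.take (k - i) ++ sfx).take t).foldl (fun v b => μ b v) a) ∨ (((g'.take (k - i) ++ sfx).take s).foldl (fun v b => μ b v) a ≠ ((g'.take (k - i) ++ sfx).take t).foldl (fun v b => μ b v) a ∧ ((g'.take (k - i) ++ sfx).take s).foldl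 (fun v b => μ b v) a ≠ ((g'.take (k - i) ++ sfx).take t).foldl (fun v b => μ b v) (μ c a) ∧ ((g'.take (k - i) ++ sfx).take s).foldl (fun v b => μ b v) (μ c a) ≠ ((g'.take (k - i) ++ sfx).take t).foldl (fun v b => μ b v) a ∧ ((g'.take (k - i) ++ sfx).take s).foldl (fun v b => μ b v) (μ c a) ≠ ((g'.take (k - i) ++ sfx).take t).foldl (fun v b => μ b v) (μ c a))))
    (h₂ : ∀ s ∈ Finset.range (k + 1), ∀ t ∈ Finset.range (k + 1),
      (((((g'.drop (k - i)).reverse ++ sfx).take s).foldl (fun v b => μ b v) (g'.foldl (fun v b => μ b v) a) = (((g'.drop (k - i)).reverse ++ sfx).take t).foldl (fun v b => μ b v) (g'.foldl (fun v b => μ b v) a) ∧ (((g'.drop (k - i)).reverse ++ sfx).take s).foldl (fun v b => μ b v) (μ c (g'.foldl (fun v b => μ b v) a)) = (((g'.drop (k - i)).reverse ++ sfx).take t).foldl (fun v b => μ b v) (μ c (g'.foldl (fun v b => μ b v) a))) ∨ ((((g'.drop (k - i)).reverse ++ sfx).take s).foldl (fun v b => μ b v) (g'.foldl (fun v b =>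 μ b v) a) = (((g'.drop (k - i)).reverse ++ sfx).take t).foldl (fun v b => μ b v) (μ c (g'.foldl (fun v b => μ b v) a)) ∧ (((g'.drop (k - i)).reverse ++ sfx).take s).foldl (fun v b => μ b v) (μ c (g'.foldl (fun v b => μ b v) a)) = (((g'.drop (k - i)).reverse ++ sfx).take t).foldl (fun v b => μ b v) (g'.foldl (fun v b => μ b v) a)) ∨ ((((g'.drop (k - i)).reverse ++ sfx).take s).foldl (fun v b => μ b v) (g'.foldl (fun v b => μ b v) a) ≠ (((g'.drop (k - i)).reverse ++ sfx).take t).foldl (fun v b => μ b v) (g'.foldl (fun v b => μ b v) a) ∧ (((g'.drop (k - i)).reverse ++ sfx).take s).foldl (fun v b => μ b v) (g'.foldl (fun v b => μ b v) a) ≠ (((g'.drop (k - i)).reverse ++ sfx).take t).foldl (fun v b => μ b v) (μ c (g'.foldl (fun v b => μ b v) a)) ∧ (((g'.drop (k - i)).reverse ++ sfx).take s).foldl (fun v b => μ b v) (μ c (g'.foldl (fun v b => μ b v) a)) ≠ (((g'.drop (k - i)).reverse ++ sfx).take t).foldl (fun v b => μ b v) (g'.foldl (fun v b => μ b v) a)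 ∧ (((g'.drop (k - i)).reverse ++ sfx).take s).foldl (fun v b => μ b v) (μ c (g'.foldl (fun v b => μ b v) a)) ≠ (((g'.drop (k - i)).reverse ++ sfx).take t).foldl (fun v b => μ b v) (μ c (g'.foldl (fun v b => μ b v) a))))) :
    (∀ s ∈ Finset.range (k - i + 1), ∀ t ∈ Finset.range (k - i + 1),
      (((g'.take s).foldl (fun v b => μ b v) a = (g'.take t).foldl (fun v b => μ b v) a ∧ (g'.take s).foldl (fun v b => μ b v) (μ c a) = (g'.take t).foldl (fun v b => μ b v) (μ c a)) ∨ ((g'.take s).foldl (fun v b => μ b v) a = (g'.take t).foldl (fun v b => μ b v) (μ c a) ∧ (g'.take s).foldl (fun v b => μ b v) (μ c a) = (g'.take t).foldl (fun v b => μ b v) a) ∨ ((g'.take s).foldl (fun v b => μ b v) a ≠ (g'.take t).foldl (fun v b => μ b v) a ∧ (g'.take s).foldl (fun v b => μ b v) a ≠ (g'.take t).foldl (fun v b => μ b v) (μ c a) ∧ (g'.take s).foldl (fun v b => μ b v) (μ c a) ≠ (g'.take t).foldl (fun v b => μ b v) a ∧ (g'.take s).foldl (fun v b => μ b v) (μ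 c a) ≠ (g'.take t).foldl (fun v b => μ b v) (μ c a)))) ∧
    (∀ s ∈ Finset.range (k - i + 1), ∀ t ∈ Finset.range (k - i + 1),
      (((g'.take (k - i + s)).foldl (fun v b => μ b v) a = (g'.take (k - i + t)).foldl (fun v b => μ b v) a ∧ (g'.take (k - i + s)).foldl (fun v b => μ b v) (μ c a) = (g'.take (k - i + t)).foldl (fun v b => μ b v) (μ c a)) ∨ ((g'.take (k - i + s)).foldl (fun v b => μ b v) a = (g'.take (k - i + t)).foldl (fun v b => μ b v) (μ c a) ∧ (g'.take (k - i + s)).foldl (fun v b => μ b v) (μ c a) = (g'.take (k - i + t)).foldl (fun v b => μ b v) a) ∨ ((g'.take (k - i + s)).foldl (fun v b => μ b v) a ≠ (g'.take (k - i + t)).foldl (fun v b => μ b v) a ∧ (g'.take (k - i + s)).foldl (fun v b => μ b v) a ≠ (g'.take (k - i + t)).foldl (fun v b => μ b v) (μ c a) ∧ (g'.take (k - i + s)).foldl (fun v b => μ b v) (μ c a) ≠ (g'.take (k - i + t)).foldl (fun v b => μ b v) a ∧ (g'.take (k - i + s)).foldl (fun v b => μ b v) (μ c a) ≠ (g'.take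 (k - i + t)).foldl (fun v b => μ b v) (μ c a)))) := by
  constructor
  · intro s hs t ht
    rw [Finset.mem_range] at hs ht
    have h := h₁ s (Finset.mem_range.2 (by omega)) t (Finset.mem_range.2 (by omega))
    rw [← traj_first_half μ hl (show s ≤ k - i by omega) a, ← traj_first_half μ hl (show s ≤ k - i by omega) (μ c a),
      ← traj_first_half μ hl (show t ≤ k - i by omega) a, ← traj_first_half μ hl (show t ≤ k - i by omega) (μ c a)] at h
    exact h
  · intro s hs t ht
    rw [Finset.mem_range] at hs ht
    have h := h₂ (k - i - s) (Finset.mem_range.2 (by omega)) (k - i - t) (Finset.mem_range.2 (by omega))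
    rw [hstr, ← traj_second_half μ hμ hl (show s ≤ k - i by omega) a,
      ← traj_second_half μ hμ hl (show s ≤ k - i by omega) (μ c a),
      ← traj_second_half μ hμ hl (show t ≤ k - i by omega) a,
      ← traj_second_half μ hμ hl (show t ≤ k - i by omega) (μ c a)] at h
    exact h

/-- **Counted supply of GOOD structures.**  For three fixed-point-free involutions, a colour `c`, a scale `k`, a forbidden set
`S` and a fixed-point bound `Φ` for nonempty reduced words of length `≤ 2k+1`:
`(n·2^k - 2(k+1)|S|·2^k - 3(k+1)²·2^k·Φ)² ≤ (n² - n)·(n·2^k + Σ_{i<k} 3^i · #{good structures of length 2k-2i})`,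
where a structure `(a, g')` of length `2k - 2i` counts as good as soon as the predicate `good i` follows from: the structure data,
`S`-avoidance at all `2(2k-2i+1)` points, and HALF-CLEANNESS (rungs at positions both `≤ k-i` or both `≥ k-i` pairwise equal,
swapped or disjoint).  Proof: run `sameColourSupply_restricted` (p116043) on the darts that avoid `S` and are self-clean — all but
`2(k+1)|S|·2^k + 3(k+1)²·2^k·Φ` of them (`card_darts_avoiding_ge`, `card_selfUnclean_le`) — and inherit both properties
(`structure_avoids_of_darts_avoid`, `structure_halfClean_of_darts_clean`).  What is left uncounted is exactly the MUTUAL defects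
between the two halves (memo `memo-k9-dart-bookkeeping.md` §3). -/
theorem goodStructureSupply (n k Φ : ℕ) (μ : Fin 3 → Equiv.Perm (Fin n)) (c : Fin 3) (S : Finset (Fin n))
    (hμ : ∀ b, μ b * μ b = 1) (hfix : ∀ b v, μ b v ≠ v)
    (hΦ : ∀ w : List (Fin 3), w ≠ [] → List.IsChain (· ≠ ·) w → w.length ≤ 2 * k + 1 →
      ((Finset.univ : Finset (Fin n)).filter (fun x => w.foldl (fun v b => μ b v) x = x)).card ≤ Φ)
    (good : ℕ → Fin n × List (Fin 3) → Prop) [∀ i, DecidablePred (good i)]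
    (hgood : (∀ i < k, ∀ (a : Fin n) (g' : List (Fin 3)), g'.length = 2 * k - 2 * i → List.IsChain (· ≠ ·) g' →
      g'.head? ≠ some c → g'.getLast? ≠ some c → μ c (g'.foldl (fun v b => μ b v) a) = g'.foldl (fun v b => μ b v) (μ c a) →
      (∀ t ∈ Finset.range (2 * k - 2 * i + 1), (g'.take t).foldl (fun v b => μ b v) a ∉ S ∧ (g'.take t).foldl (fun v b => μ b v) (μ c a) ∉ S) →
      (∀ s ∈ Finset.range (k - i + 1), ∀ t ∈ Finset.range (k - i + 1),
        (((g'.take s).foldl (fun v b => μ b v) a = (g'.take t).foldl (fun v b => μ b v) a ∧ (g'.take s).foldl (fun v b => μ b v) (μ c a) = (g'.take t).foldl (fun v b => μ b v) (μ c a)) ∨ ((g'.take s).foldl (fun v b => μ b v) a = (g'.take t).foldl (fun v b => μ b v) (μ c a) ∧ (g'.take s).foldl (fun v b => μ b v) (μ c a) = (g'.take t).foldl (fun v b => μ b v) a) ∨ ((g'.take s).foldl (fun v b => μ b v) a ≠ (g'.take t).foldl (fun v b => μ b v) a ∧ (g'.take s).foldl (fun v b => μ b v) a ≠ (g'.take t).foldl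 (fun v b => μ b v) (μ c a) ∧ (g'.take s).foldl (fun v b => μ b v) (μ c a) ≠ (g'.take t).foldl (fun v b => μ b v) a ∧ (g'.take s).foldl (fun v b => μ b v) (μ c a) ≠ (g'.take t).foldl (fun v b => μ b v) (μ c a)))) →
      (∀ s ∈ Finset.range (k - i + 1), ∀ t ∈ Finset.range (k - i + 1),
        (((g'.take (k - i + s)).foldl (fun v b => μ b v) a = (g'.take (k - i + t)).foldl (fun v b => μ b v) a ∧ (g'.take (k - i + s)).foldl (fun v b => μ b v) (μ c a) = (g'.take (k - i + t)).foldl (fun v b => μ b v) (μ c a)) ∨ ((g'.take (k - i + s)).foldl (fun v b => μ b v) a = (g'.take (k - i + t)).foldl (fun v b => μ b v) (μ c a) ∧ (g'.take (k - i + s)).foldl (fun v b => μ b v) (μ c a) = (g'.take (k - i + t)).foldl (fun v b => μ b v) a) ∨ ((g'.take (k - i + s)).foldl (fun v b => μ b v) a ≠ (g'.take (k - i + t)).foldl (fun v b => μ b v) a ∧ (g'.take (k - i + s)).foldl (fun v b => μ b v) a ≠ (g'.take (k - i + t)).foldl (fun v b => μ b v) (μ c a) ∧ (g'.take (k - i +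 s)).foldl (fun v b => μ b v) (μ c a) ≠ (g'.take (k - i + t)).foldl (fun v b => μ b v) a ∧ (g'.take (k - i + s)).foldl (fun v b => μ b v) (μ c a) ≠ (g'.take (k - i + t)).foldl (fun v b => μ b v) (μ c a)))) →
      good i (a, g'))) :
    (n * 2 ^ k - 2 * (k + 1) * S.card * 2 ^ k - 3 * (k + 1) ^ 2 * (2 ^ k * Φ)) ^ 2 ≤
      (n * n - n) * (n * 2 ^ k + ∑ i ∈ Finset.range k, 3 ^ i * ((((Finset.univ : Finset (Fin n)) ×ˢ (((Finset.univ : Finset (List.Vector (Fin 3) (2 * k - 2 * i))).image (fun v => v.toList)).filter (fun g => List.IsChain (· ≠ ·) g ∧ g.head? ≠ some c ∧ g.getLast? ≠ some c))).filter (fun p => μ c (p.2.foldl (fun v b => μ b v) p.1) = p.2.foldl (fun v b => μ b v) (μ c p.1))).filter (good i)).card) := by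
  -- all darts, the `S`-free ones, the rung (self-cleanness) condition
  set D := ((Finset.univ : Finset (Fin n)) ×ˢ (((Finset.univ : Finset (List.Vector (Fin 3) k)).image (fun v => v.toList)).filter (fun g => List.IsChain (· ≠ ·) g ∧ g.head? ≠ some c))) with hD
  have hDcard : D.card = n * 2 ^ k := by
    rw [hD, Finset.card_product, Finset.card_univ, Fintype.card_fin, card_redWords k c]
  set A := D.filter (fun p : Fin n × List (Fin 3) => ∀ t ∈ Finset.range (k + 1), (p.2.take t).foldl (fun v b => μ b v) p.1 ∉ S ∧ (p.2.take t).foldl (fun v b => μ b v) (μ c p.1) ∉ S) with hA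
  have hdec : DecidablePred (fun p : Fin n × List (Fin 3) => ∀ s ∈ Finset.range (k + 1), ∀ t ∈ Finset.range (k + 1), ((((p.2).take s).foldl (fun v b => μ b v) p.1 = ((p.2).take t).foldl (fun v b => μ b v) p.1 ∧ ((p.2).take s).foldl (fun v b => μ b v) (μ c p.1) = ((p.2).take t).foldl (fun v b => μ b v) (μ c p.1)) ∨ (((p.2).take s).foldl (fun v b => μ b v) p.1 = ((p.2).take t).foldl (fun v b => μ b v) (μ c p.1) ∧ ((p.2).take s).foldl (fun v b => μ b v) (μ c p.1) = ((p.2).take t).foldl (fun v b => μ b v) p.1) ∨ (((p.2).take s).foldl (fun v b => μ b v) p.1 ≠ ((p.2).take t).foldl (fun v b => μ b v) p.1 ∧ ((p.2).take s).foldl (fun v b => μ b v) p.1 ≠ ((p.2).take t).foldl (fun v b => μ b v) (μ c p.1) ∧ ((p.2).take s).foldl (fun v b => μ b v) (μ c p.1) ≠ ((p.2).take t).foldl (fun v b => μ b v) p.1 ∧ ((p.2).take s).foldl (fun v b => μ b v) (μ c p.1) ≠ ((p.2).take t).foldl (fun v b => μ b v) (μ c p.1)))) := by infer_instance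
  set G := @Finset.filter (Fin n × List (Fin 3)) (fun p : Fin n × List (Fin 3) => ∀ s ∈ Finset.range (k + 1), ∀ t ∈ Finset.range (k + 1), ((((p.2).take s).foldl (fun v b => μ b v) p.1 = ((p.2).take t).foldl (fun v b => μ b v) p.1 ∧ ((p.2).take s).foldl (fun v b => μ b v) (μ c p.1) = ((p.2).take t).foldl (fun v b => μ b v) (μ c p.1)) ∨ (((p.2).take s).foldl (fun v b => μ b v) p.1 = ((p.2).take t).foldl (fun v b => μ b v) (μ c p.1) ∧ ((p.2).take s).foldl (fun v b => μ b v) (μ c p.1) = ((p.2).take t).foldl (fun v b => μ b v) p.1) ∨ (((p.2).take s).foldl (fun v b => μ b v) p.1 ≠ ((p.2).take t).foldl (fun v b => μ b v) p.1 ∧ ((p.2).take s).foldl (fun v b => μ b v) p.1 ≠ ((p.2).take t).foldl (fun v b => μ b v) (μ c p.1) ∧ ((p.2).take s).foldl (fun v b => μ b v) (μ c p.1) ≠ ((p.2).take t).foldl (fun v b => μ b v) p.1 ∧ ((p.2).take s).foldl (fun v b => μ b v) (μ c p.1) ≠ ((p.2).take t).foldl (fun v b => μ b v) (μ c p.1))))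 hdec A with hG
  have hGA : G ⊆ A := Finset.filter_subset _ _
  have hAD : A ⊆ D := Finset.filter_subset _ _
  have hGD : G ⊆ D := hGA.trans hAD
  -- size of `G`: all darts but the `S`-hitting and the self-unclean ones
  have hAlow : n * 2 ^ k ≤ A.card + 2 * (k + 1) * S.card * 2 ^ k := by
    have := card_darts_avoiding_ge μ hμ c k S
    rw [← hD, ← hA] at this
    exact this
  have hbad := @card_selfUnclean_le n μ hμ c k Φ hΦ (fun p : Fin n × List (Fin 3) => ∀ s ∈ Finset.range (k + 1), ∀ t ∈ Finset.range (k + 1), ((((p.2).take s).foldl (fun v b => μ b v) p.1 = ((p.2).take t).foldl (fun v b => μ b v) p.1 ∧ ((p.2).take s).foldl (fun v b => μ b v) (μ c p.1) = ((p.2).take t).foldl (fun v b => μ b v) (μ c p.1)) ∨ (((p.2).take s).foldl (fun v b => μ b v) p.1 = ((p.2).take t).foldl (fun v b => μ b v) (μ c p.1) ∧ ((p.2).take s).foldl (fun v b => μ b v) (μ c p.1) = ((p.2).take t).foldl (fun v b => μ b v) p.1) ∨ (((p.2).take s).foldl (fun v b => μ b v) p.1 ≠ ((p.2).take t).foldl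 (fun v b => μ b v) p.1 ∧ ((p.2).take s).foldl (fun v b => μ b v) p.1 ≠ ((p.2).take t).foldl (fun v b => μ b v) (μ c p.1) ∧ ((p.2).take s).foldl (fun v b => μ b v) (μ c p.1) ≠ ((p.2).take t).foldl (fun v b => μ b v) p.1 ∧ ((p.2).take s).foldl (fun v b => μ b v) (μ c p.1) ≠ ((p.2).take t).foldl (fun v b => μ b v) (μ c p.1)))) hdec (fun p hp => hp)
  rw [← hD] at hbad
  have hcov : A ⊆ G ∪ @Finset.filter (Fin n × List (Fin 3)) (fun p : Fin n × List (Fin 3) => ¬ (∀ s ∈ Finset.range (k + 1), ∀ t ∈ Finset.range (k + 1), ((((p.2).take s).foldl (fun v b => μ b v) p.1 = ((p.2).take t).foldl (fun v b => μ b v) p.1 ∧ ((p.2).take s).foldl (fun v b => μ b v) (μ c p.1) = ((p.2).take t).foldl (fun v b => μ b v) (μ c p.1)) ∨ (((p.2).take s).foldl (fun v b => μ b v) p.1 = ((p.2).take t).foldl (fun v b => μ b v) (μ c p.1) ∧ ((p.2).take s).foldl (fun v b => μ b v) (μ c p.1) = ((p.2).take t).foldl (fun v b => μ b v) p.1) ∨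 (((p.2).take s).foldl (fun v b => μ b v) p.1 ≠ ((p.2).take t).foldl (fun v b => μ b v) p.1 ∧ ((p.2).take s).foldl (fun v b => μ b v) p.1 ≠ ((p.2).take t).foldl (fun v b => μ b v) (μ c p.1) ∧ ((p.2).take s).foldl (fun v b => μ b v) (μ c p.1) ≠ ((p.2).take t).foldl (fun v b => μ b v) p.1 ∧ ((p.2).take s).foldl (fun v b => μ b v) (μ c p.1) ≠ ((p.2).take t).foldl (fun v b => μ b v) (μ c p.1)))))
      (fun p => @instDecidableNot _ (hdec p)) D := by
    intro p hp
    rw [Finset.mem_union]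
    by_cases h : ∀ s ∈ Finset.range (k + 1), ∀ t ∈ Finset.range (k + 1), ((((p.2).take s).foldl (fun v b => μ b v) p.1 = ((p.2).take t).foldl (fun v b => μ b v) p.1 ∧ ((p.2).take s).foldl (fun v b => μ b v) (μ c p.1) = ((p.2).take t).foldl (fun v b => μ b v) (μ c p.1)) ∨ (((p.2).take s).foldl (fun v b => μ b v) p.1 = ((p.2).take t).foldl (fun v b => μ b v) (μ c p.1) ∧ ((p.2).take s).foldl (fun v b => μ b v) (μ c p.1) = ((p.2).take t).foldl (fun v b => μ b v) p.1) ∨ (((p.2).take s).foldl (fun v b => μ b v) p.1 ≠ ((p.2).take t).foldl (fun v b => μ b v) p.1 ∧ ((p.2).take s).foldl (fun v b => μ b v) p.1 ≠ ((p.2).take t).foldl (fun v b => μ b v) (μ c p.1) ∧ ((p.2).take s).foldl (fun v b => μ b v) (μ c p.1) ≠ ((p.2).take t).foldl (fun v b => μ b v) p.1 ∧ ((p.2).take s).foldl (fun v b => μ b v) (μ c p.1) ≠ ((p.2).take t).foldl (fun v b => μ b v) (μ c p.1)))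
    · exact Or.inl (Finset.mem_filter.2 ⟨hp, h⟩)
    · exact Or.inr (Finset.mem_filter.2 ⟨hAD hp, h⟩)
  have hAle : A.card ≤ G.card + 3 * (k + 1) ^ 2 * (2 ^ k * Φ) :=
    (Finset.card_le_card hcov).trans ((Finset.card_union_le _ _).trans (Nat.add_le_add_left hbad _))
  have hGcard : n * 2 ^ k - 2 * (k + 1) * S.card * 2 ^ k - 3 * (k + 1) ^ 2 * (2 ^ k * Φ) ≤ G.card := by omega
  have hGle : G.card ≤ n * 2 ^ k := by rw [← hDcard]; exact Finset.card_le_card hGD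
  -- restricted supply on `G`
  have hmain := sameColourSupply_restricted n k μ c hμ hfix G hGD
  refine (Nat.pow_le_pow_left hGcard 2).trans (hmain.trans (Nat.mul_le_mul_left _ ?_))
  refine Nat.add_le_add hGle (Finset.sum_le_sum (fun i hi => ?_))
  have hik : i < k := Finset.mem_range.1 hi
  rw [← card_words i, ← Finset.card_product]
  refine Finset.card_le_card ?_
  intro r hr
  rw [Finset.mem_filter, Finset.mem_product, Finset.mem_filter, Finset.mem_product, Finset.mem_filter] at hr
  obtain ⟨⟨hs, ⟨-, hl, hch, hh, hlast⟩, hstr⟩, hd₁, hd₂⟩ := hr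
  rw [mem_words] at hl
  have hd₁A := hGA hd₁
  have hd₂A := hGA hd₂
  rw [hG, Finset.mem_filter] at hd₁ hd₂
  rw [hA, Finset.mem_filter] at hd₁A hd₂A
  rw [Finset.mem_product]
  refine ⟨hs, Finset.mem_filter.2 ⟨Finset.mem_filter.2 ⟨Finset.mem_product.2 ⟨Finset.mem_univ _,
    Finset.mem_filter.2 ⟨mem_words.2 hl, hch, hh, hlast⟩⟩, hstr⟩, ?_⟩⟩
  have havoid := structure_avoids_of_darts_avoid μ hμ c hik S hl hstr hd₁A.2 hd₂A.2
  have hhalf := structure_halfClean_of_darts_clean μ hμ c hik hl hstr hd₁.2 hd₂.2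
  exact hgood i hik r.2.1 r.2.2 hl hch hh hlast hstr havoid hhalf.1 hhalf.2

/-- **Registered form** (`stub_goodStructureSupply`, a `--supports` sub-goal of crux `stmt-MatrixMultiplication-10883`, helper for
the open core `stub_poorRigidCore`): `goodStructureSupply`, fully quantified.  Under the core's POOR (`stub_poorUniform`, p116729,
with `L = 2k+1 ≤ n^{1/4}`) and `|S| ≤ n^{3/4}` the subtracted terms are `o(n·2^k)`, so at `2^k ≥ 4n` at least `n²` ordered collisions
of good darts survive: a counted supply of `S`-free half-clean same-colour structures at some scale `m ≤ 2k`, whose only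
possible defects are mutual ones between the two halves. -/
theorem stub_goodStructureSupply : ∀ (n k Φ : ℕ) (μ : Fin 3 → Equiv.Perm (Fin n)) (c : Fin 3) (S : Finset (Fin n)) (good : ℕ → Fin n × List (Fin 3) → Prop) [∀ i, DecidablePred (good i)], (∀ b, μ b * μ b = 1) → (∀ b v, μ b v ≠ v) → (∀ w : List (Fin 3), w ≠ [] → List.IsChain (· ≠ ·) w → w.length ≤ 2 * k + 1 → ((Finset.univ : Finset (Fin n)).filter (fun x => w.foldl (fun v b => μ b v) x = x)).card ≤ Φ) → (∀ i < k, ∀ (a : Fin n) (g' : List (Fin 3)), g'.length = 2 * k - 2 * i → List.IsChain (· ≠ ·) g' → g'.head? ≠ some c → g'.getLast? ≠ some c → μ c (g'.foldl (fun v b => μ b v) a) = g'.foldl (fun v b => μ b v) (μ c a) → (∀ t ∈ Finset.range (2 * k - 2 * i + 1), (g'.take t).foldl (fun v b => μ b v) a ∉ S ∧ (g'.take t).foldl (fun v b => μ b v) (μ c a) ∉ S) → (∀ s ∈ Finset.range (k - i + 1), ∀ t ∈ Finset.range (k - i + 1), (((g'.take s).foldl (fun v b => μ b v) a = (g'.take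 t).foldl (fun v b => μ b v) a ∧ (g'.take s).foldl (fun v b => μ b v) (μ c a) = (g'.take t).foldl (fun v b => μ b v) (μ c a)) ∨ ((g'.take s).foldl (fun v b => μ b v) a = (g'.take t).foldl (fun v b => μ b v) (μ c a) ∧ (g'.take s).foldl (fun v b => μ b v) (μ c a) = (g'.take t).foldl (fun v b => μ b v) a) ∨ ((g'.take s).foldl (fun v b => μ b v) a ≠ (g'.take t).foldl (fun v b => μ b v) a ∧ (g'.take s).foldl (fun v b => μ b v) a ≠ (g'.take t).foldl (fun v b => μ b v) (μ c a) ∧ (g'.take s).foldl (fun v b => μ b v) (μ c a) ≠ (g'.take t).foldl (fun v b => μ b v) a ∧ (g'.take s).foldl (fun v b => μ b v) (μ c a) ≠ (g'.take t).foldl (fun v b => μ b v) (μ c a)))) → (∀ s ∈ Finset.range (k - i + 1), ∀ t ∈ Finset.range (k - i + 1), (((g'.take (k - i + s)).foldl (fun v b => μ b v) a = (g'.take (k - i + t)).foldl (fun v b => μ b v) a ∧ (g'.take (k - i + s)).foldl (fun v b => μ b v) (μ c a) = (g'.take (k - i + t)).foldl (fun v b => μ b v) (μ c a)) ∨ ((g'.take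 (k - i + s)).foldl (fun v b => μ b v) a = (g'.take (k - i + t)).foldl (fun v b => μ b v) (μ c a) ∧ (g'.take (k - i + s)).foldl (fun v b => μ b v) (μ c a) = (g'.take (k - i + t)).foldl (fun v b => μ b v) a) ∨ ((g'.take (k - i + s)).foldl (fun v b => μ b v) a ≠ (g'.take (k - i + t)).foldl (fun v b => μ b v) a ∧ (g'.take (k - i + s)).foldl (fun v b => μ b v) a ≠ (g'.take (k - i + t)).foldl (fun v b => μ b v) (μ c a) ∧ (g'.take (k - i + s)).foldl (fun v b => μ b v) (μ c a) ≠ (g'.take (k - i + t)).foldl (fun v b => μ b v) a ∧ (g'.take (k - i + s)).foldl (fun v b => μ b v) (μ c a) ≠ (g'.take (k - i + t)).foldl (fun v b => μ b v) (μ c a)))) → good i (a, g')) → (n * 2 ^ k - 2 * (k + 1) * S.card * 2 ^ k - 3 * (k + 1) ^ 2 * (2 ^ k * Φ)) ^ 2 ≤ (n * n - n) * (n * 2 ^ k + ∑ i ∈ Finset.range k, 3 ^ i * ((((Finset.univ : Finset (Fin n)) ×ˢ (((Finset.univ : Finset (List.Vector (Fin 3) (2 * k - 2 * i))).image (fun v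 => v.toList)).filter (fun g => List.IsChain (· ≠ ·) g ∧ g.head? ≠ some c ∧ g.getLast? ≠ some c))).filter (fun p => μ c (p.2.foldl (fun v b => μ b v) p.1) = p.2.foldl (fun v b => μ b v) (μ c p.1))).filter (good i)).card) :=
  fun n k Φ μ c S good _ hμ hfix hΦ hgood => goodStructureSupply n k Φ μ c S hμ hfix hΦ good hgood

end Summit.MatrixMultiplication.MatrixMultiplication.Theorems.HyperoctahedralThreshold.GoodStructureSupply
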